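import Summits.QuantumFields.YangMills.Theorems.BalabanUVNodesK0Stub1V0CurrentFrechet
import HarnessLib

/-!
# K0⁷ STUB 1 (`stub_prop8StepCoP13`), sub-target S4b «the (δ∕δA′)V pieces at objects», brick 10 (capstone of bricks 6–9):
# **PROP. 4 FOR SECT. F's `W = (δ∕δA′)V` AT THE SETUP TORUS, ONE LEVEL, MODULO THE PORT LETTERS** — ONE theorem delivering `W` on `PBond P 0 → 𝔸` with
# (i) the (63)-certificate `DV(A′) = ⟨W(A′), ·⟩₍₂₇₎` for Sect. F's `V(A′) = ½⟨D, MD⟩ − ⟨QA′, MD⟩ + V₀(A′ − HD(A′))` ((157)∕(80) in the (87)–(88) multiplier form),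
# (ii) `hWd` (holomorphy on the (115)-ball) and (iii) `hWq` (the pointwise (98)-slot `‖W Y‖ ≤ C₄r²`, `C₄` EXPLICIT IN THE LETTERS) in the exact shape of the route
# `UnitScaleTilt`'s Prop. 6 for (158) (`FlatSmallSolution158.existsUnique_smallSolution158`, k0-s1-w1's `…AtRecord` §1)

Cell `pub-ymgap`, width seat `pub-ymgap-k0-s1-w2` g2 (director-ym №197 ∕ HUMAN RULING D-0149; plan g77–g81 W-SEAT-START-LIST §k0-s1, w2 ↦ S4b).
`--kind proof --supports stmt-QuantumFields-20541 --as helper`; count-neutral.  [15] = [Balaban1985Variational]; [B6] = [Balaban1984PropagatorsII].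

WHY.  S4b = «[15] Props 4–5 at objects»: the `W`-slot (`hWq`, `hWd`) of Prop. 6 for (158) with a LATTICE-UNIFORM `C₄` (print p. 293 «C₄ depends on d and L only»;
(165)–(166) need it).  g0 (p584681 … p590049) delivered the V₀-group's current `W₀` with a uniform constant; bricks 6–9 of this seat delivered the `H`-groups in
print's (87)–(88) multiplier form (no `‖∂*∂‖`), the chain rule for `V₀ ∘ T`, the complex∕bilinear calculus with transposes as letters, and `W₀`'s Fréchet
certificate.  THIS FILE composes them into the ONE statement the S6 assembly cites: for the Sect. F data at the Setup torus — the multi-level average `Q`, print's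
`H`, the multiplier `M = (QGQ*)⁻¹ − a`, the chart remainder `D` of (49) with its derivative family `𝔇` and the transposes `Qᵗ, Hᵗ, 𝔇(A′)ᵗ` for the pairing (27), ALL
PARAMETERS displayed with their adjunction identities — and the seven printed LETTERS as functions of the (115)-size `r` ((3.132) `O₁`; `Qᵗ`: `q₀`; (73)ᵀ: `θ₀r`;
(46)ᵀ: `h₀`; (55): `C_Dr²`; the average: `qr`; (57)–(58): the chart point `A′ − HD(A′)` has size `≤ ℓr`), there is a map `W` with (i)–(iii) and
`C₄ = θ₀O₁(C_Da₃ + q) + q₀O₁C_D + (1 + θ₀a₃h₀)·C_V·ℓ²`, `C_V = (d−1)‖ρ‖(64+138‖τ‖)` (g0), on the ball `r < a₃`, `ℓa₃ ≤ 1/16`.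

WHAT IS PROVED (sorry-free; no definition; axioms standard).
* `slot_arith` — the arithmetic of «gathering together all these estimates» (p. 292): for `r ≤ a₃` and non-negative letters,
  `θ₀rO₁(C_Dr² + qr) + q₀O₁C_Dr² + (1 + θ₀rh₀)C_V(ℓr)² ≤ C₄r²`.
* ★★★ `exists_sectF_W_oneLevel` — the theorem described above (one level `k`: fine weight `1`, gradient factor `L^k`, any block index type `β` with weights `wB ≥ 0`,
  `wB′`; every `Params` with `4 ≤ d`; every finite-dimensional complete unital `*`-algebra fibre with letters `ρ, τ`).
* ★★★ `exists_sectF_W_levOf` — the MULTI-LEVEL twin at the record's weights `w m b = ((L^{j(b)})·L^{−k})^m` on a one-step-collared `Ω` (k0-s1-w1's `_recordDom`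
  shape; g0's multi-level constant `C_V′ = 64(d−1)L⁶‖ρ‖ + (d−1)L⁶(136+2L²)‖ρ‖‖τ‖`).
HONEST SCOPE.  Composition of this seat's bricks 8–9 and g0's current BY NAME; `Q, M, H, D, 𝔇, Qᵗ, Hᵗ, 𝔇ᵗ, B, BE` are PARAMETERS (at the record: the componentwise
extensions of `QE D`, `EE D − aE D w`, `hOp …` of UST `FlatCubeOperators` via `FlatScalarExtension`, UST `FlatChart47`'s `D`, the trace pairings — the S1∕S6
junction), the seven letters are HYPOTHESES ([B6] Prop. 2.7 = [5] (3.132); (46), (55), (57)–(58), (73): the d = 4 port ∕ S2); nothing of [15]'s analysis asserted; `stub_prop8StepCoP13` ∕ K0⁷ NOT closed; N07 NOT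
discharged; counts unmoved (28∕28 · 5∕27); one finite 𝕋⁴ programme at fixed ε — R4 closes the conditional finite-𝕋⁴ rung `BalabanLadder.UV` only, never the summit;
the YM mass gap (Clay) is NOT proved by any of this; nothing continuum ∕ ℝ⁴ ∕ OS.  No `sorry`, no `def`, no `instance`, no `notation`.

References: [15] (27) p.282, (45)–(47) p.285, (55)–(58) pp.286–287, (63) p.287, (73) p.289, (80) p.290, (87)–(90) p.291, p.292, Prop. 4 (97)–(98) pp.292–293, Prop. 6
p.295, (115) p.294, (157)–(158) p.302, (165)–(166) p.304; [B6] Prop. 2.7 (2.149) p.249.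
-/

set_option autoImplicit false

noncomputable section

namespace Summit.QuantumFields.YangMills.Theorems.K0Stub1SectFWSlotOneLevel

open Literature.MathematicalPhysics.QuantumFieldTheory.Balaban1983to89
open B4Sect5Torus (TSite)
open B9Eq39Adjoint (bondPair)
open B11Eq26ActionExpansion (V0)
open B9SectCLatticeCarrier (Bond)
open B11Eq115Space (NegSup JetSup levOf)
open B11Eq111FrakG (nabla115)
open B11Eq63V0GroupCurrent (curV0)
open Summit.QuantumFields.YangMills.Theorems.K0Stub1SectFMultiplierFormAnalytic (hasFDerivAt_sectF_VC_pair differentiableOn_sectF_WC sectF_WC_slot98)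
open Summit.QuantumFields.YangMills.Theorems.K0Stub1V0SlotAtRecord (exists_W_V0_flat)
open Summit.QuantumFields.YangMills.Theorems.K0Stub1V0SlotAtRecordLevels (exists_W_V0_flat_levOf)
open Summit.QuantumFields.YangMills.Theorems.K0Stub1V0CurrentFrechet (hasFDerivAt_V0_of_line_certificate)

/-! ## §1  «Gathering together all these estimates» — the arithmetic of the constant -/

/-- **THE CONSTANT OF (97)∕(98) FOR SECT. F's `W`, GATHERED** (p. 292 «Gathering together all these estimates we get the following proposition»): for `r ≤ a₃`
and non-negative letters, `θ₀r·O₁(C_Dr² + qr) + q₀O₁C_Dr² + (1 + θ₀r·h₀)·C_V(ℓr)² ≤ (θ₀O₁(C_Da₃ + q) + q₀O₁C_D + (1 + θ₀a₃h₀)C_Vℓ²)·r²`.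
[cite: Balaban1985Variational, (97)–(98) pp.292–293] -/
theorem slot_arith {r a₃ θ₀ O₁ CD q q₀ h₀ CV ℓ : ℝ} (hra : r ≤ a₃) (hθ₀ : 0 ≤ θ₀) (hO₁ : 0 ≤ O₁) (hCD : 0 ≤ CD)
    (hh₀ : 0 ≤ h₀) (hCV : 0 ≤ CV) :
    θ₀ * r * (O₁ * (CD * r ^ 2 + q * r)) + q₀ * (O₁ * (CD * r ^ 2)) + (1 + θ₀ * r * h₀) * (CV * (ℓ * r) ^ 2)
      ≤ (θ₀ * O₁ * (CD * a₃ + q) + q₀ * O₁ * CD + (1 + θ₀ * a₃ * h₀) * CV * ℓ ^ 2) * r ^ 2 := by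
  have e : θ₀ * r * (O₁ * (CD * r ^ 2 + q * r)) + q₀ * (O₁ * (CD * r ^ 2)) + (1 + θ₀ * r * h₀) * (CV * (ℓ * r) ^ 2)
      = (θ₀ * O₁ * (CD * r + q) + q₀ * O₁ * CD + (1 + θ₀ * r * h₀) * CV * ℓ ^ 2) * r ^ 2 := by ring
  rw [e]
  apply mul_le_mul_of_nonneg_right _ (sq_nonneg r)
  have h1 : θ₀ * O₁ * (CD * r + q) ≤ θ₀ * O₁ * (CD * a₃ + q) := by
    apply mul_le_mul_of_nonneg_left _ (mul_nonneg hθ₀ hO₁)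
    nlinarith
  have h2 : (1 + θ₀ * r * h₀) * CV * ℓ ^ 2 ≤ (1 + θ₀ * a₃ * h₀) * CV * ℓ ^ 2 := by
    apply mul_le_mul_of_nonneg_right _ (sq_nonneg ℓ)
    apply mul_le_mul_of_nonneg_right _ hCV
    nlinarith [mul_nonneg hθ₀ hh₀]
  linarith

/-! ## §2  ★★★ Prop. 4 for Sect. F's `W` at the Setup torus, one level, modulo the port letters -/

section Main

variable {P : Params}
variable {𝔸 : Type*} [NormedRing 𝔸] [NormedAlgebra ℂ 𝔸] [CompleteSpace 𝔸] [NormOneClass 𝔸] [StarRing 𝔸] [StarModule ℂ 𝔸]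
  [FiniteDimensional ℂ 𝔸]
variable {β : Type*} [Fintype β]

/-- ★★★ **PROPOSITION 4 FOR SECT. F's `W = (δ∕δA′)V` AT THE SETUP TORUS, ONE LEVEL `k` (`η = L^{−k}`), MODULO THE PORT LETTERS.**  Data (all displayed):
the pairing (27) `BE` on fine fields and a symmetric pairing `B` on block data; the average `Q`, print's `H`, the `B`-symmetric multiplier `M` (print's
`(QGQ*)⁻¹ − a`, (87)∕(137)), their transposes `Qᵗ`, `Hᵗ`; the chart remainder `D` of (49) with derivative family `𝔇` and transposes `𝔇(A′)ᵗ` on the (115)-ball of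
radius `a₃`, `D` and `A′ ↦ 𝔇(A′)ᵗ` holomorphic there; the fibre letters `ρ, τ` of g0's V₀-current.  Letters (hypotheses, as functions of the (115)-size `r` of `A′`):
(3.132) `O₁` (for `M`, block weights `wB → wB′`), `q₀` (`Qᵗ`), (73)ᵀ `θ₀r` (`𝔇(A′)ᵗ`), (46)ᵀ `h₀` (`Hᵗ`), (55) `C_Dr²` (`D A′`), the average `qr` (`QA′`), (57)–(58)
`ℓr` (both sizes of the chart point `A′ − H(D A′)`), with `ℓa₃ ≤ 1/16`.  THEN there are g0's dictionary `e` and V₀-current `W₀` (EXPOSED with its defining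
equation through lit-balaban's `curV0 ρ τ 1`, so that later letters about `W₀` — e.g. 𝔤-valuedness — transfer) and `W = [Dt M(D − QA′) − Qt M D] + [W₀∘T − Dt Ht W₀∘T]`
(its formula a conjunct) with:
(i) for every `A′` in the open ball, `D[½B(DA, M DA) − B(QA, M DA) + V₀(A − H(DA))](A′) = BE(W A′, ·)` — `W` IS `(δ∕δA′)V` of (157)∕(158) in the sense (63);
(ii) `W` is `ℂ`-differentiable on the ball (`hWd`); (iii) `r < a₃`, `|Y| ≤ r`, `L^k|∇Y| ≤ r` ⇒ `‖W Y b‖ ≤ C₄r²` at every bond (`hWq`) with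
`C₄ = θ₀O₁(C_Da₃ + q) + q₀O₁C_D + (1 + θ₀a₃h₀)·(d−1)‖ρ‖(64+138‖τ‖)·ℓ²` — a number in the letters only.
[cite: Balaban1985Variational, Prop. 4 (97)–(98) pp.292–293, (157)–(158) p.302, (63) p.287, (87)–(90) p.291, (55)–(58) pp.286–287, (73) p.289, (46) p.285] -/
theorem exists_sectF_W_oneLevel (P : Params) (hd : 4 ≤ P.d) (k : ℕ) [Fact ((0 : ℝ) < (P.L : ℝ))] [Fact ((0 : ℝ) < ((P.L : ℝ))⁻¹ ^ k)]
    (ρ : (𝔸 →L[ℂ] ℂ) →L[ℂ] 𝔸) (τ : 𝔸 →L[ℂ] ℂ) (hρ : ∀ (ℓ' : 𝔸 →L[ℂ] ℂ) (X : 𝔸), τ (ρ ℓ' * X) = ℓ' X)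
    (hτ : ∀ a b : 𝔸, τ (a * b) = τ (b * a)) (hτs : ∀ a : 𝔸, τ (star a) = starRingEnd ℂ (τ a)) (hτ1 : ∀ X : 𝔸, ‖τ X‖ ≤ ‖X‖)
    -- the pairings: (27) on fine fields, a symmetric one on block data
    (BE : (PBond P 0 → 𝔸) →L[ℂ] (PBond P 0 → 𝔸) →L[ℂ] ℂ)
    (hBE : ∀ Y δ : PBond P 0 → 𝔸, BE Y δ = bondPair (((P.L : ℝ))⁻¹ ^ k) P.d (τ : 𝔸 →ₗ[ℂ] ℂ) (fun μ x => Y ⟨x, μ⟩) (fun μ x => δ ⟨x, μ⟩))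
    (B : (β → 𝔸) →L[ℂ] (β → 𝔸) →L[ℂ] ℂ) (hB : ∀ a b, B a b = B b a)
    -- the operators and their transposes
    (Q : (PBond P 0 → 𝔸) →L[ℂ] (β → 𝔸)) (M : (β → 𝔸) →L[ℂ] (β → 𝔸)) (hM : ∀ a b, B (M a) b = B a (M b))
    (H : (β → 𝔸) →L[ℂ] (PBond P 0 → 𝔸)) (Qt : (β → 𝔸) →L[ℂ] (PBond P 0 → 𝔸)) (hQt : ∀ X δ, BE (Qt X) δ = B X (Q δ))
    (Ht : (PBond P 0 → 𝔸) →L[ℂ] (β → 𝔸)) (hHt : ∀ Z X, BE Z (H X) = B (Ht Z) X)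
    -- the chart remainder `D` of (49), its derivative family and transposes, on the (115)-ball of radius `a₃`
    {a₃ : ℝ} (D : (PBond P 0 → 𝔸) → (β → 𝔸)) (𝔇 : (PBond P 0 → 𝔸) → ((PBond P 0 → 𝔸) →L[ℂ] (β → 𝔸)))
    (Dt : (PBond P 0 → 𝔸) → ((β → 𝔸) →L[ℂ] (PBond P 0 → 𝔸)))
    (hD : ∀ A' : PBond P 0 → 𝔸, (∀ b, ‖A' b‖ < a₃) → (∀ (s : Site P 0) (μ ν : Fin P.d), (P.L : ℝ) ^ k * ‖A' ⟨s.shift ν, μ⟩ - A' ⟨s, μ⟩‖ < a₃) →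
      HasFDerivAt D (𝔇 A') A')
    (hDt : ∀ A' : PBond P 0 → 𝔸, (∀ b, ‖A' b‖ < a₃) → (∀ (s : Site P 0) (μ ν : Fin P.d), (P.L : ℝ) ^ k * ‖A' ⟨s.shift ν, μ⟩ - A' ⟨s, μ⟩‖ < a₃) →
      ∀ X δ, BE (Dt A' X) δ = B X (𝔇 A' δ))
    (hDdiff : DifferentiableOn ℂ D {Y : PBond P 0 → 𝔸 | (∀ b, ‖Y b‖ < a₃) ∧
      ∀ (s : Site P 0) (μ ν : Fin P.d), (P.L : ℝ) ^ k * ‖Y ⟨s.shift ν, μ⟩ - Y ⟨s, μ⟩‖ < a₃})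
    (hDtdiff : DifferentiableOn ℂ Dt {Y : PBond P 0 → 𝔸 | (∀ b, ‖Y b‖ < a₃) ∧
      ∀ (s : Site P 0) (μ ν : Fin P.d), (P.L : ℝ) ^ k * ‖Y ⟨s.shift ν, μ⟩ - Y ⟨s, μ⟩‖ < a₃})
    -- block weights and the letters
    (wB wB' : β → ℝ) (hwB : ∀ i, 0 ≤ wB i) {O₁ q₀ θ₀ h₀ CD q ℓ : ℝ} (hO₁ : 0 ≤ O₁) (hθ₀ : 0 ≤ θ₀) (hh₀ : 0 ≤ h₀) (hCD : 0 ≤ CD) (hℓ : 0 ≤ ℓ)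
    (hℓa : ℓ * a₃ ≤ 1 / 16)
    (h3132 : ∀ (X : β → 𝔸) (s : ℝ), (∀ i, wB i * ‖X i‖ ≤ s) → ∀ i, wB' i * ‖M X i‖ ≤ O₁ * s)
    (hQt' : ∀ (X : β → 𝔸) (s : ℝ), (∀ i, wB' i * ‖X i‖ ≤ s) → ∀ b, ‖Qt X b‖ ≤ q₀ * s)
    (h73t : ∀ (A' : PBond P 0 → 𝔸) (r : ℝ), (∀ b, ‖A' b‖ ≤ r) →
      (∀ (s : Site P 0) (μ ν : Fin P.d), (P.L : ℝ) ^ k * ‖A' ⟨s.shift ν, μ⟩ - A' ⟨s, μ⟩‖ ≤ r) → r < a₃ →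
      ∀ (X : β → 𝔸) (s : ℝ), (∀ i, wB' i * ‖X i‖ ≤ s) → ∀ b, ‖Dt A' X b‖ ≤ θ₀ * r * s)
    (h46t : ∀ (Z : PBond P 0 → 𝔸) (s : ℝ), (∀ b, ‖Z b‖ ≤ s) → ∀ i, wB' i * ‖Ht Z i‖ ≤ h₀ * s)
    (h55 : ∀ (A' : PBond P 0 → 𝔸) (r : ℝ), (∀ b, ‖A' b‖ ≤ r) →
      (∀ (s : Site P 0) (μ ν : Fin P.d), (P.L : ℝ) ^ k * ‖A' ⟨s.shift ν, μ⟩ - A' ⟨s, μ⟩‖ ≤ r) → r < a₃ → ∀ i, wB i * ‖D A' i‖ ≤ CD * r ^ 2)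
    (hQ : ∀ (A' : PBond P 0 → 𝔸) (r : ℝ), (∀ b, ‖A' b‖ ≤ r) → ∀ i, wB i * ‖Q A' i‖ ≤ q * r)
    (h57 : ∀ (A' : PBond P 0 → 𝔸) (r : ℝ), (∀ b, ‖A' b‖ ≤ r) →
      (∀ (s : Site P 0) (μ ν : Fin P.d), (P.L : ℝ) ^ k * ‖A' ⟨s.shift ν, μ⟩ - A' ⟨s, μ⟩‖ ≤ r) → r < a₃ →
      (∀ b, ‖(A' - H (D A')) b‖ ≤ ℓ * r) ∧
        ∀ (s : Site P 0) (μ ν : Fin P.d), (P.L : ℝ) ^ k * ‖(A' - H (D A')) ⟨s.shift ν, μ⟩ - (A' - H (D A')) ⟨s, μ⟩‖ ≤ ℓ * r) :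
    ∃ (e : Site P 0 ≃ TSite P.d (fun _ => P.sitesPerDir 0)) (W₀ W : (PBond P 0 → 𝔸) → (PBond P 0 → 𝔸)),
      (∀ (x : Site P 0) (μ : Fin P.d), e (x.shift μ) = B9SectCLatticeCarrier.shift μ (e x)) ∧
      (∀ (Y : PBond P 0 → 𝔸) (b : PBond P 0), W₀ Y b =
        NegSup.equiv _ 𝔸 (curV0 (L := (P.L : ℝ)) (η := ((P.L : ℝ))⁻¹ ^ k)
          (lev₀ := fun _ : Bond P.d (fun _ => P.sitesPerDir 0) => k) (lev₁ := fun _ : Bond P.d (fun _ => P.sitesPerDir 0) × Fin P.d => k)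
          (Dc := nabla115 (((P.L : ℝ))⁻¹ ^ k) (1 : Bond P.d (fun _ => P.sitesPerDir 0) → 𝔸ˣ)) ρ τ 1
          ((JetSup.equiv _ _ _).symm fun b' => Y ⟨e.symm b'.1, b'.2⟩)) (e b.src, b.dir)) ∧
      (∀ A' : PBond P 0 → 𝔸, W A' = (Dt A' (M (D A' - Q A')) - Qt (M (D A'))) + (W₀ (A' - H (D A')) - Dt A' (Ht (W₀ (A' - H (D A')))))) ∧
      (∀ A' : PBond P 0 → 𝔸, (∀ b, ‖A' b‖ < a₃) →
        (∀ (s : Site P 0) (μ ν : Fin P.d), (P.L : ℝ) ^ k * ‖A' ⟨s.shift ν, μ⟩ - A' ⟨s, μ⟩‖ < a₃) →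
        HasFDerivAt (fun A : PBond P 0 → 𝔸 => 2⁻¹ * B (D A) (M (D A)) - B (Q A) (M (D A))
            + V0 (LatticeFieldCalculus.shiftEquiv (P := P) (j := 0)) (fun _ _ => (1 : 𝔸ˣ)) (((P.L : ℝ))⁻¹ ^ k) P.d (τ : 𝔸 →ₗ[ℂ] ℂ)
                (fun μ x => (A - H (D A)) ⟨x, μ⟩))
          (BE (W A')) A') ∧
      DifferentiableOn ℂ W {Y : PBond P 0 → 𝔸 | (∀ b, ‖Y b‖ < a₃) ∧
        ∀ (s : Site P 0) (μ ν : Fin P.d), (P.L : ℝ) ^ k * ‖Y ⟨s.shift ν, μ⟩ - Y ⟨s, μ⟩‖ < a₃} ∧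
      (∀ (Y : PBond P 0 → 𝔸) (r : ℝ), r < a₃ → (∀ b, ‖Y b‖ ≤ r) →
        (∀ (s : Site P 0) (μ ν : Fin P.d), (P.L : ℝ) ^ k * ‖Y ⟨s.shift ν, μ⟩ - Y ⟨s, μ⟩‖ ≤ r) →
        ∀ b, ‖W Y b‖ ≤
          (θ₀ * O₁ * (CD * a₃ + q) + q₀ * O₁ * CD
            + (1 + θ₀ * a₃ * h₀) * (((P.d - 1 : ℕ) : ℝ) * ‖ρ‖ * (64 + 138 * ‖τ‖)) * ℓ ^ 2) * r ^ 2) := by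
  obtain ⟨e, W₀, he, hdef, hW₀q, hW₀d, -, hcert⟩ := exists_W_V0_flat P hd k ρ τ hρ hτ hτs hτ1
  have hη : ((P.L : ℝ))⁻¹ ^ k ≠ 0 := (Fact.out : (0 : ℝ) < ((P.L : ℝ))⁻¹ ^ k).ne'
  -- the V₀-current's Fréchet certificate (brick 9) at every configuration
  have hΦ : ∀ Y : PBond P 0 → 𝔸, HasFDerivAt (fun Y' : PBond P 0 → 𝔸 =>
      V0 (LatticeFieldCalculus.shiftEquiv (P := P) (j := 0)) (fun _ _ => (1 : 𝔸ˣ)) (((P.L : ℝ))⁻¹ ^ k) P.d (τ : 𝔸 →ₗ[ℂ] ℂ)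
        (fun μ x => Y' ⟨x, μ⟩)) (BE (W₀ Y)) Y :=
    fun Y => hasFDerivAt_V0_of_line_certificate hd hη τ hτ BE hBE W₀ Y (hcert Y)
  -- the current: H-groups in multiplier form + composed V₀-group
  refine ⟨e, W₀, fun A' => (Dt A' (M (D A' - Q A')) - Qt (M (D A'))) + (W₀ (A' - H (D A')) - Dt A' (Ht (W₀ (A' - H (D A'))))),
    he, hdef, fun _ => rfl, ?_, ?_, ?_⟩
  · -- (i) the (63)-certificate
    intro A' h0 h1
    have h := hasFDerivAt_sectF_VC_pair B BE Q M H D hB hM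
      (fun Y' : PBond P 0 → 𝔸 => V0 (LatticeFieldCalculus.shiftEquiv (P := P) (j := 0)) (fun _ _ => (1 : 𝔸ˣ)) (((P.L : ℝ))⁻¹ ^ k) P.d
        (τ : 𝔸 →ₗ[ℂ] ℂ) (fun μ x => Y' ⟨x, μ⟩))
      (hD A' h0 h1) (hΦ (A' - H (D A'))) Qt (Dt A') hQt (hDt A' h0 h1) Ht hHt
    simpa only using h
  · -- (ii) holomorphy on the ball
    have hT : DifferentiableOn ℂ (fun A : PBond P 0 → 𝔸 => A - H (D A)) {Y : PBond P 0 → 𝔸 | (∀ b, ‖Y b‖ < a₃) ∧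
        ∀ (s : Site P 0) (μ ν : Fin P.d), (P.L : ℝ) ^ k * ‖Y ⟨s.shift ν, μ⟩ - Y ⟨s, μ⟩‖ < a₃} :=
      differentiableOn_id.sub (H.differentiable.comp_differentiableOn hDdiff)
    have hg : DifferentiableOn ℂ (fun A : PBond P 0 → 𝔸 => W₀ (A - H (D A))) {Y : PBond P 0 → 𝔸 | (∀ b, ‖Y b‖ < a₃) ∧
        ∀ (s : Site P 0) (μ ν : Fin P.d), (P.L : ℝ) ^ k * ‖Y ⟨s.shift ν, μ⟩ - Y ⟨s, μ⟩‖ < a₃} :=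
      hW₀d.comp_differentiableOn hT
    exact differentiableOn_sectF_WC Q M D Qt Ht Dt (fun A => W₀ (A - H (D A))) hDdiff hDtdiff hg
  · -- (iii) the (98)-slot
    intro Y r hr hY0 hY1 b
    -- the chart point and the V₀-current's slot there
    obtain ⟨hT0, hT1⟩ := h57 Y r hY0 hY1 hr
    have hℓr : ℓ * r < 1 / 16 := by
      rcases hℓ.eq_or_lt with h0 | hpos
      · rw [← h0, zero_mul]; norm_num
      · exact lt_of_lt_of_le (mul_lt_mul_of_pos_left hr hpos) hℓa
    have hg : ∀ b', (fun _ : PBond P 0 => (1 : ℝ)) b' * ‖W₀ (Y - H (D Y)) b'‖ ≤ (((P.d - 1 : ℕ) : ℝ) * ‖ρ‖ * (64 + 138 * ‖τ‖)) * (ℓ * r) ^ 2 :=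
      fun b' => by rw [one_mul]; exact hW₀q (Y - H (D Y)) (ℓ * r) hℓr hT0 hT1 b'
    have hslot := sectF_WC_slot98 M Q D Qt (Dt Y) Ht Y (W₀ (Y - H (D Y))) wB wB' (fun _ => (1 : ℝ)) hwB (fun _ => zero_le_one)
      h3132 (fun X s hX b' => by rw [one_mul]; exact hQt' X s hX b') (fun X s hX b' => by rw [one_mul]; exact h73t Y r hY0 hY1 hr X s hX b')
      (fun Z s hZ i => h46t Z s (fun b' => by simpa only [one_mul] using hZ b') i) (h55 Y r hY0 hY1 hr) (hQ Y r hY0) hg b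
    rw [one_mul] at hslot
    refine hslot.trans ?_
    have hCV : 0 ≤ ((P.d - 1 : ℕ) : ℝ) * ‖ρ‖ * (64 + 138 * ‖τ‖) := by positivity
    exact slot_arith hr.le hθ₀ hO₁ hCD hh₀ hCV


/-! ## §3  The multi-level twin: the record's level weights `w m b = ((L^{j(b)})·L^{−k})^m` on a one-step-collared domain sequence -/

/-- ★★★ **THE SAME AT THE RECORD's MULTI-LEVEL WEIGHTS** (the weights of k0-s1-w1's `existsUnique_smallSolution158_recordDom`: `w m b = ((L^{j(b)})·L^{−k})^m`,
`j(b) = levOf Ω k b₋`, `Ω` one-step-collared; g0's `…V0SlotAtRecordLevels` ∕ brick 9 `exists_V0_current_frechet_flat_levOf` for the V₀-current): the letters now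
read the WEIGHTED sizes (`w₁|A′| ≤ r`, `w₂L^k|∇A′| ≤ r`; outputs with `w₃`), and the conclusion is `∃ W` with the (63)-certificate on the weighted open ball,
`hWd` there, and `hWq`: `w₃(b)‖W Y b‖ ≤ C₄r²` with `C₄ = θ₀O₁(C_Da₃ + q) + q₀O₁C_D + (1 + θ₀a₃h₀)·C_V′·ℓ²`,
`C_V′ = 64(d−1)L⁶‖ρ‖ + (d−1)L⁶(136+2L²)‖ρ‖‖τ‖` (g0's multi-level constant). [cite: Balaban1985Variational, Prop. 4 (97)–(98) pp.292–293, (115) p.294, (152) p.301, (157)–(158) p.302] -/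
theorem exists_sectF_W_levOf (P : Params) (hd : 4 ≤ P.d) (k : ℕ) [Fact ((0 : ℝ) < (P.L : ℝ))] [Fact ((0 : ℝ) < ((P.L : ℝ))⁻¹ ^ k)]
    (Ω : ℕ → Set (Site P 0))
    (hcollar : ∀ (j : ℕ) (x : Site P 0) (ν : Fin P.d), x ∈ Ω (j + 1) → x.shift ν ∈ Ω j ∧ x.unshift ν ∈ Ω j)
    (w : ℕ → PBond P 0 → ℝ) (hw : ∀ m b, w m b = ((P.L : ℝ) ^ levOf Ω k b.src * ((P.L : ℝ)⁻¹) ^ k) ^ m)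
    (ρ : (𝔸 →L[ℂ] ℂ) →L[ℂ] 𝔸) (τ : 𝔸 →L[ℂ] ℂ) (hρ : ∀ (ℓ' : 𝔸 →L[ℂ] ℂ) (X : 𝔸), τ (ρ ℓ' * X) = ℓ' X)
    (hτ : ∀ a b : 𝔸, τ (a * b) = τ (b * a)) (hτs : ∀ a : 𝔸, τ (star a) = starRingEnd ℂ (τ a)) (hτ1 : ∀ X : 𝔸, ‖τ X‖ ≤ ‖X‖)
    (BE : (PBond P 0 → 𝔸) →L[ℂ] (PBond P 0 → 𝔸) →L[ℂ] ℂ)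
    (hBE : ∀ Y δ : PBond P 0 → 𝔸, BE Y δ = bondPair (((P.L : ℝ))⁻¹ ^ k) P.d (τ : 𝔸 →ₗ[ℂ] ℂ) (fun μ x => Y ⟨x, μ⟩) (fun μ x => δ ⟨x, μ⟩))
    (B : (β → 𝔸) →L[ℂ] (β → 𝔸) →L[ℂ] ℂ) (hB : ∀ a b, B a b = B b a)
    (Q : (PBond P 0 → 𝔸) →L[ℂ] (β → 𝔸)) (M : (β → 𝔸) →L[ℂ] (β → 𝔸)) (hM : ∀ a b, B (M a) b = B a (M b))
    (H : (β → 𝔸) →L[ℂ] (PBond P 0 → 𝔸)) (Qt : (β → 𝔸) →L[ℂ] (PBond P 0 → 𝔸)) (hQt : ∀ X δ, BE (Qt X) δ = B X (Q δ))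
    (Ht : (PBond P 0 → 𝔸) →L[ℂ] (β → 𝔸)) (hHt : ∀ Z X, BE Z (H X) = B (Ht Z) X)
    {a₃ : ℝ} (D : (PBond P 0 → 𝔸) → (β → 𝔸)) (𝔇 : (PBond P 0 → 𝔸) → ((PBond P 0 → 𝔸) →L[ℂ] (β → 𝔸)))
    (Dt : (PBond P 0 → 𝔸) → ((β → 𝔸) →L[ℂ] (PBond P 0 → 𝔸)))
    (hD : ∀ A' : PBond P 0 → 𝔸, (∀ b, w 1 b * ‖A' b‖ < a₃) →
      (∀ (b : PBond P 0) (ν : Fin P.d), w 2 b * (P.L : ℝ) ^ k * ‖A' ⟨b.src.shift ν, b.dir⟩ - A' b‖ < a₃) → HasFDerivAt D (𝔇 A') A')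
    (hDt : ∀ A' : PBond P 0 → 𝔸, (∀ b, w 1 b * ‖A' b‖ < a₃) →
      (∀ (b : PBond P 0) (ν : Fin P.d), w 2 b * (P.L : ℝ) ^ k * ‖A' ⟨b.src.shift ν, b.dir⟩ - A' b‖ < a₃) → ∀ X δ, BE (Dt A' X) δ = B X (𝔇 A' δ))
    (hDdiff : DifferentiableOn ℂ D {Y : PBond P 0 → 𝔸 | (∀ b, w 1 b * ‖Y b‖ < a₃) ∧
      ∀ (b : PBond P 0) (ν : Fin P.d), w 2 b * (P.L : ℝ) ^ k * ‖Y ⟨b.src.shift ν, b.dir⟩ - Y b‖ < a₃})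
    (hDtdiff : DifferentiableOn ℂ Dt {Y : PBond P 0 → 𝔸 | (∀ b, w 1 b * ‖Y b‖ < a₃) ∧
      ∀ (b : PBond P 0) (ν : Fin P.d), w 2 b * (P.L : ℝ) ^ k * ‖Y ⟨b.src.shift ν, b.dir⟩ - Y b‖ < a₃})
    (wB wB' : β → ℝ) (hwB : ∀ i, 0 ≤ wB i) {O₁ q₀ θ₀ h₀ CD q ℓ : ℝ} (hO₁ : 0 ≤ O₁) (hθ₀ : 0 ≤ θ₀) (hh₀ : 0 ≤ h₀) (hCD : 0 ≤ CD) (hℓ : 0 ≤ ℓ)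
    (hℓa : ℓ * a₃ ≤ 1 / 16)
    (h3132 : ∀ (X : β → 𝔸) (s : ℝ), (∀ i, wB i * ‖X i‖ ≤ s) → ∀ i, wB' i * ‖M X i‖ ≤ O₁ * s)
    (hQt' : ∀ (X : β → 𝔸) (s : ℝ), (∀ i, wB' i * ‖X i‖ ≤ s) → ∀ b, w 3 b * ‖Qt X b‖ ≤ q₀ * s)
    (h73t : ∀ (A' : PBond P 0 → 𝔸) (r : ℝ), (∀ b, w 1 b * ‖A' b‖ ≤ r) →
      (∀ (b : PBond P 0) (ν : Fin P.d), w 2 b * (P.L : ℝ) ^ k * ‖A' ⟨b.src.shift ν, b.dir⟩ - A' b‖ ≤ r) → r < a₃ →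
      ∀ (X : β → 𝔸) (s : ℝ), (∀ i, wB' i * ‖X i‖ ≤ s) → ∀ b, w 3 b * ‖Dt A' X b‖ ≤ θ₀ * r * s)
    (h46t : ∀ (Z : PBond P 0 → 𝔸) (s : ℝ), (∀ b, w 3 b * ‖Z b‖ ≤ s) → ∀ i, wB' i * ‖Ht Z i‖ ≤ h₀ * s)
    (h55 : ∀ (A' : PBond P 0 → 𝔸) (r : ℝ), (∀ b, w 1 b * ‖A' b‖ ≤ r) →
      (∀ (b : PBond P 0) (ν : Fin P.d), w 2 b * (P.L : ℝ) ^ k * ‖A' ⟨b.src.shift ν, b.dir⟩ - A' b‖ ≤ r) → r < a₃ →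
      ∀ i, wB i * ‖D A' i‖ ≤ CD * r ^ 2)
    (hQ : ∀ (A' : PBond P 0 → 𝔸) (r : ℝ), (∀ b, w 1 b * ‖A' b‖ ≤ r) → ∀ i, wB i * ‖Q A' i‖ ≤ q * r)
    (h57 : ∀ (A' : PBond P 0 → 𝔸) (r : ℝ), (∀ b, w 1 b * ‖A' b‖ ≤ r) →
      (∀ (b : PBond P 0) (ν : Fin P.d), w 2 b * (P.L : ℝ) ^ k * ‖A' ⟨b.src.shift ν, b.dir⟩ - A' b‖ ≤ r) → r < a₃ →
      (∀ b, w 1 b * ‖(A' - H (D A')) b‖ ≤ ℓ * r) ∧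
        ∀ (b : PBond P 0) (ν : Fin P.d), w 2 b * (P.L : ℝ) ^ k * ‖(A' - H (D A')) ⟨b.src.shift ν, b.dir⟩ - (A' - H (D A')) b‖ ≤ ℓ * r) :
    ∃ (e : Site P 0 ≃ TSite P.d (fun _ => P.sitesPerDir 0)) (W₀ W : (PBond P 0 → 𝔸) → (PBond P 0 → 𝔸)),
      (∀ (x : Site P 0) (μ : Fin P.d), e (x.shift μ) = B9SectCLatticeCarrier.shift μ (e x)) ∧
      (∀ (Y : PBond P 0 → 𝔸) (b : PBond P 0), W₀ Y b =
        NegSup.equiv _ 𝔸 (curV0 (L := (P.L : ℝ)) (η := ((P.L : ℝ))⁻¹ ^ k)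
          (lev₀ := fun b' : Bond P.d (fun _ => P.sitesPerDir 0) => levOf (fun j => e.symm ⁻¹' Ω j) k b'.1)
          (lev₁ := fun p : Bond P.d (fun _ => P.sitesPerDir 0) × Fin P.d => levOf (fun j => e.symm ⁻¹' Ω j) k p.1.1)
          (Dc := nabla115 (((P.L : ℝ))⁻¹ ^ k) (1 : Bond P.d (fun _ => P.sitesPerDir 0) → 𝔸ˣ)) ρ τ 1
          ((JetSup.equiv _ _ _).symm fun b' => Y ⟨e.symm b'.1, b'.2⟩)) (e b.src, b.dir)) ∧
      (∀ A' : PBond P 0 → 𝔸, W A' = (Dt A' (M (D A' - Q A')) - Qt (M (D A'))) + (W₀ (A' - H (D A')) - Dt A' (Ht (W₀ (A' - H (D A')))))) ∧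
      (∀ A' : PBond P 0 → 𝔸, (∀ b, w 1 b * ‖A' b‖ < a₃) →
        (∀ (b : PBond P 0) (ν : Fin P.d), w 2 b * (P.L : ℝ) ^ k * ‖A' ⟨b.src.shift ν, b.dir⟩ - A' b‖ < a₃) →
        HasFDerivAt (fun A : PBond P 0 → 𝔸 => 2⁻¹ * B (D A) (M (D A)) - B (Q A) (M (D A))
            + V0 (LatticeFieldCalculus.shiftEquiv (P := P) (j := 0)) (fun _ _ => (1 : 𝔸ˣ)) (((P.L : ℝ))⁻¹ ^ k) P.d (τ : 𝔸 →ₗ[ℂ] ℂ)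
                (fun μ x => (A - H (D A)) ⟨x, μ⟩))
          (BE (W A')) A') ∧
      DifferentiableOn ℂ W {Y : PBond P 0 → 𝔸 | (∀ b, w 1 b * ‖Y b‖ < a₃) ∧
        ∀ (b : PBond P 0) (ν : Fin P.d), w 2 b * (P.L : ℝ) ^ k * ‖Y ⟨b.src.shift ν, b.dir⟩ - Y b‖ < a₃} ∧
      (∀ (Y : PBond P 0 → 𝔸) (r : ℝ), r < a₃ → (∀ b, w 1 b * ‖Y b‖ ≤ r) →
        (∀ (b : PBond P 0) (ν : Fin P.d), w 2 b * (P.L : ℝ) ^ k * ‖Y ⟨b.src.shift ν, b.dir⟩ - Y b‖ ≤ r) →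
        ∀ b, w 3 b * ‖W Y b‖ ≤
          (θ₀ * O₁ * (CD * a₃ + q) + q₀ * O₁ * CD
            + (1 + θ₀ * a₃ * h₀) * (64 * ((P.d - 1 : ℕ) : ℝ) * ((P.L : ℝ) ^ 2) ^ 3 * ‖ρ‖
                + ((P.d - 1 : ℕ) : ℝ) * ((P.L : ℝ) ^ 2) ^ 3 * (136 + 2 * (P.L : ℝ) ^ 2) * ‖ρ‖ * ‖τ‖) * ℓ ^ 2) * r ^ 2) := by
  obtain ⟨e, W₀, he, hdef, hW₀q, hW₀d, hcert⟩ := exists_W_V0_flat_levOf P hd k Ω hcollar w hw ρ τ hρ hτ hτs hτ1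
  have hη : ((P.L : ℝ))⁻¹ ^ k ≠ 0 := (Fact.out : (0 : ℝ) < ((P.L : ℝ))⁻¹ ^ k).ne'
  have hw3 : ∀ b, 0 ≤ w 3 b := fun b => by rw [hw]; positivity
  have hΦ : ∀ Y : PBond P 0 → 𝔸, HasFDerivAt (fun Y' : PBond P 0 → 𝔸 =>
      V0 (LatticeFieldCalculus.shiftEquiv (P := P) (j := 0)) (fun _ _ => (1 : 𝔸ˣ)) (((P.L : ℝ))⁻¹ ^ k) P.d (τ : 𝔸 →ₗ[ℂ] ℂ)
        (fun μ x => Y' ⟨x, μ⟩)) (BE (W₀ Y)) Y :=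
    fun Y => hasFDerivAt_V0_of_line_certificate hd hη τ hτ BE hBE W₀ Y (hcert Y)
  refine ⟨e, W₀, fun A' => (Dt A' (M (D A' - Q A')) - Qt (M (D A'))) + (W₀ (A' - H (D A')) - Dt A' (Ht (W₀ (A' - H (D A'))))),
    he, hdef, fun _ => rfl, ?_, ?_, ?_⟩
  · intro A' h0 h1
    have h := hasFDerivAt_sectF_VC_pair B BE Q M H D hB hM
      (fun Y' : PBond P 0 → 𝔸 => V0 (LatticeFieldCalculus.shiftEquiv (P := P) (j := 0)) (fun _ _ => (1 : 𝔸ˣ)) (((P.L : ℝ))⁻¹ ^ k) P.d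
        (τ : 𝔸 →ₗ[ℂ] ℂ) (fun μ x => Y' ⟨x, μ⟩))
      (hD A' h0 h1) (hΦ (A' - H (D A'))) Qt (Dt A') hQt (hDt A' h0 h1) Ht hHt
    simpa only using h
  · have hT : DifferentiableOn ℂ (fun A : PBond P 0 → 𝔸 => A - H (D A)) {Y : PBond P 0 → 𝔸 | (∀ b, w 1 b * ‖Y b‖ < a₃) ∧
        ∀ (b : PBond P 0) (ν : Fin P.d), w 2 b * (P.L : ℝ) ^ k * ‖Y ⟨b.src.shift ν, b.dir⟩ - Y b‖ < a₃} :=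
      differentiableOn_id.sub (H.differentiable.comp_differentiableOn hDdiff)
    have hg : DifferentiableOn ℂ (fun A : PBond P 0 → 𝔸 => W₀ (A - H (D A))) {Y : PBond P 0 → 𝔸 | (∀ b, w 1 b * ‖Y b‖ < a₃) ∧
        ∀ (b : PBond P 0) (ν : Fin P.d), w 2 b * (P.L : ℝ) ^ k * ‖Y ⟨b.src.shift ν, b.dir⟩ - Y b‖ < a₃} :=
      hW₀d.comp_differentiableOn hT
    exact differentiableOn_sectF_WC Q M D Qt Ht Dt (fun A => W₀ (A - H (D A))) hDdiff hDtdiff hg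
  · intro Y r hr hY0 hY1 b
    obtain ⟨hT0, hT1⟩ := h57 Y r hY0 hY1 hr
    have hℓr : ℓ * r < 1 / 16 := by
      rcases hℓ.eq_or_lt with h0 | hpos
      · rw [← h0, zero_mul]; norm_num
      · exact lt_of_lt_of_le (mul_lt_mul_of_pos_left hr hpos) hℓa
    have hg := hW₀q (Y - H (D Y)) (ℓ * r) hℓr hT0 hT1
    have hslot := sectF_WC_slot98 M Q D Qt (Dt Y) Ht Y (W₀ (Y - H (D Y))) wB wB' (w 3) hwB hw3
      h3132 hQt' (h73t Y r hY0 hY1 hr) h46t (h55 Y r hY0 hY1 hr) (hQ Y r hY0) hg b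
    refine hslot.trans ?_
    have hCV : 0 ≤ 64 * ((P.d - 1 : ℕ) : ℝ) * ((P.L : ℝ) ^ 2) ^ 3 * ‖ρ‖
        + ((P.d - 1 : ℕ) : ℝ) * ((P.L : ℝ) ^ 2) ^ 3 * (136 + 2 * (P.L : ℝ) ^ 2) * ‖ρ‖ * ‖τ‖ := by positivity
    exact slot_arith hr.le hθ₀ hO₁ hCD hh₀ hCV

end Main

end Summit.QuantumFields.YangMills.Theorems.K0Stub1SectFWSlotOneLevel

end
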